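import Summits.QuantumFields.BalabanUV.Beta.FP.SliceTransportConjugation

/-!
# `BalabanUV.Beta.FP.SliceTransportConjugationEnd` — road «FP» for binder row D1, ROUTE T, presentation T-β (W-FP-17-11 ∕ memo §23): **THE CONJUGATION-TRANSPORT
# THEOREM FOR SLICED BORDERED 2-JETS, ASSEMBLED** from `SliceTransportConjugation` (p314816…p316895): `secondVar_kkt_conj_transport` — for field ∕ multiplier
transports `A`, `Ā` with inverse letters `B A = 1` to second order and UNIMODULAR jets, the conjugated sliced 2-jet `kkt (AᵀKA)ₙ [(ĀQA)ₙ; τ(BA)ₙ]` (static slice,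
zero slice jets) has the `secondVar` of the raw 2-jet WITH THE SLICE MOVED, `kkt Kₙ [Qₙ; τBₙ]`; the slice exchange (`SliceExchangeJets`, p308565) then prices the
moved slice by Faddeev–Popov terms.  [folklore] composition of `secondVar_conj_of_unimodular`, `secondVar_transportL∕R`, `conj_kkt_base∕first∕second`.

HONEST DEPENDENCY (page 1, mandatory): continuum YM on T⁴ ⇐ BetaPertH ∧ nine spine estimates (0/9 proved); BetaPertH ⇐ (D1) ∧ (D4) ∧ CAP+tail;
G-an2-4 gates asym, D1 and NE2/3/4.  HONEST FRAMING (cell contract, verbatim): «discharging `BetaPertH` makes Bałaban's UV stability UNCONDITIONAL —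
a real constructive-QFT result; it is NOT the continuum limit and NOT the Clay problem.»  ABSOLUTE RULE (cell charter, verbatim): «No internally-minted
statement may enter as a cited fact. Every hypothesis is either kernel-proved in this package or a verbatim quotation of a PUBLISHED theorem with page
reference. The manuscript(s) under audit are NOT citable for their own disputed steps — they are the thing under adjudication; programme-internal
(2001/route/tribunal) claims are never citable.»  No `def`, no `def … : Prop`, nothing cited, 0 sorry; 0∕4 row-D1 binders; the transports' covariance ∕
unimodularity ∕ inverse letters are the dictionary's (memo §23 (T-β-1…3)); NOT (T-ID), NOT SDF, NOT D1, NOT BetaPertH, NOT continuum, NOT Clay.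
Road «FP» OWNER, b2b-balaban-beta-d1-p3 gen 17, 2026-08-22.  No existing file touched.
-/

noncomputable section

namespace Summit.QuantumFields.BalabanUV.Beta.FP.SliceTransportConjugationEnd

open Matrix
open Literature.MathematicalPhysics.QuantumFieldTheory.Balaban1983to89.Beta.Composition (kkt)
open Summit.QuantumFields.BalabanUV.Beta.D1BFx.LogDetSecondVariation (secondVar)
open Summit.QuantumFields.BalabanUV.Beta.FP.SliceTransportConjugation

section Assembled

variable {ν κ ρ : Type*} [Fintype ν] [Fintype κ] [Fintype ρ] [DecidableEq ν] [DecidableEq κ] [DecidableEq ρ]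

/-- [folklore] **CONJUGATION TRANSPORT OF A SLICED BORDERED 2-JET.**  Transports `A` (fields), `Ā` (multipliers) with inverse letters `B A = 1` to second order
and UNIMODULAR jets (`secondVar A-jets = 0`, `secondVar Ā-jets = 0`): the conjugated sliced 2-jet `(kkt (AᵀKA)ₙ [(ĀQA)ₙ; τ·(BA)ₙ])` — static slice `τ`, zero
slice jets — has the SAME `secondVar` as the raw 2-jet with the slice MOVED by `B`: `(kkt Kₙ [Qₙ; τBₙ])`.  (Then `SliceExchangeJets` prices the moved slice by
Faddeev–Popov terms — W-FP-17-11 T-β.) -/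
theorem secondVar_kkt_conj_transport (A₀ A₁ A₂ B₀ B₁ B₂ K₀ K₁ K₂ : Matrix ν ν ℝ) (Ā₀ Ā₁ Ā₂ : Matrix κ κ ℝ) (Q₀ Q₁ Q₂ : Matrix κ ν ℝ) (τ : Matrix ρ ν ℝ)
    (hA : A₀.det ≠ 0) (hĀ : Ā₀.det ≠ 0) (hM : (kkt K₀ (fromRows Q₀ (τ * B₀))).det ≠ 0)
    (b0 : B₀ * A₀ = 1) (b1 : B₁ * A₀ + B₀ * A₁ = 0) (b2 : B₂ * A₀ + (2 : ℝ) • (B₁ * A₁) + B₀ * A₂ = 0)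
    (uA : secondVar A₀ A₁ A₂ = 0) (uĀ : secondVar Ā₀ Ā₁ Ā₂ = 0) :
    secondVar (kkt (A₀ᵀ * K₀ * A₀) (fromRows (Ā₀ * Q₀ * A₀) τ))
        (kkt (A₁ᵀ * K₀ * A₀ + A₀ᵀ * K₁ * A₀ + A₀ᵀ * K₀ * A₁) (fromRows (Ā₁ * Q₀ * A₀ + Ā₀ * Q₁ * A₀ + Ā₀ * Q₀ * A₁) (0 : Matrix ρ ν ℝ)))
        (kkt (A₂ᵀ * K₀ * A₀ + (A₁ᵀ * K₁ * A₀ + A₁ᵀ * K₀ * A₁) + ((A₁ᵀ * K₁ * A₀ + A₁ᵀ * K₀ * A₁) + (A₀ᵀ * K₂ * A₀ + A₀ᵀ * K₁ * A₁ + (A₀ᵀ * K₁ * A₁ + A₀ᵀ * K₀ * A₂))))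
          (fromRows (Ā₂ * Q₀ * A₀ + (Ā₁ * Q₁ * A₀ + Ā₁ * Q₀ * A₁) + ((Ā₁ * Q₁ * A₀ + Ā₁ * Q₀ * A₁) + (Ā₀ * Q₂ * A₀ + Ā₀ * Q₁ * A₁ + (Ā₀ * Q₁ * A₁ + Ā₀ * Q₀ * A₂))))
            (0 : Matrix ρ ν ℝ)))
      = secondVar (kkt K₀ (fromRows Q₀ (τ * B₀))) (kkt K₁ (fromRows Q₁ (τ * B₁))) (kkt K₂ (fromRows Q₂ (τ * B₂))) := by
  -- the transports and their unimodularity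
  have hL : (fromBlocks A₀ᵀ 0 0 (fromBlocks Ā₀ 0 0 ((1 : ℝ) • (1 : Matrix ρ ρ ℝ)))).det ≠ 0 := by
    rw [one_smul, Matrix.det_fromBlocks_zero₁₂, Matrix.det_fromBlocks_zero₁₂, Matrix.det_one, mul_one, Matrix.det_transpose]; exact mul_ne_zero hA hĀ
  have hR : (fromBlocks A₀ 0 0 (fromBlocks Ā₀ᵀ 0 0 ((1 : ℝ) • (1 : Matrix ρ ρ ℝ)))).det ≠ 0 := by
    rw [one_smul, Matrix.det_fromBlocks_zero₁₂, Matrix.det_fromBlocks_zero₁₂, Matrix.det_one, mul_one, Matrix.det_transpose]; exact mul_ne_zero hA hĀ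
  have uL : secondVar (fromBlocks A₀ᵀ 0 0 (fromBlocks Ā₀ 0 0 ((1 : ℝ) • (1 : Matrix ρ ρ ℝ))))
      (fromBlocks A₁ᵀ 0 0 (fromBlocks Ā₁ 0 0 ((0 : ℝ) • (1 : Matrix ρ ρ ℝ))))
      (fromBlocks A₂ᵀ 0 0 (fromBlocks Ā₂ 0 0 ((0 : ℝ) • (1 : Matrix ρ ρ ℝ)))) = 0 := by
    rw [one_smul, zero_smul, secondVar_transportL A₀ A₁ A₂ Ā₀ Ā₁ Ā₂ hA hĀ, uA, uĀ, add_zero]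
  have uR : secondVar (fromBlocks A₀ 0 0 (fromBlocks Ā₀ᵀ 0 0 ((1 : ℝ) • (1 : Matrix ρ ρ ℝ))))
      (fromBlocks A₁ 0 0 (fromBlocks Ā₁ᵀ 0 0 ((0 : ℝ) • (1 : Matrix ρ ρ ℝ))))
      (fromBlocks A₂ 0 0 (fromBlocks Ā₂ᵀ 0 0 ((0 : ℝ) • (1 : Matrix ρ ρ ℝ)))) = 0 := by
    rw [one_smul, zero_smul, secondVar_transportR A₀ A₁ A₂ Ā₀ Ā₁ Ā₂ hA hĀ, uA, uĀ, add_zero]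
  have h := secondVar_conj_of_unimodular
    (fromBlocks A₀ᵀ 0 0 (fromBlocks Ā₀ 0 0 ((1 : ℝ) • (1 : Matrix ρ ρ ℝ))))
    (fromBlocks A₁ᵀ 0 0 (fromBlocks Ā₁ 0 0 ((0 : ℝ) • (1 : Matrix ρ ρ ℝ))))
    (fromBlocks A₂ᵀ 0 0 (fromBlocks Ā₂ 0 0 ((0 : ℝ) • (1 : Matrix ρ ρ ℝ))))
    (kkt K₀ (fromRows Q₀ (τ * B₀))) (kkt K₁ (fromRows Q₁ (τ * B₁))) (kkt K₂ (fromRows Q₂ (τ * B₂)))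
    (fromBlocks A₀ 0 0 (fromBlocks Ā₀ᵀ 0 0 ((1 : ℝ) • (1 : Matrix ρ ρ ℝ))))
    (fromBlocks A₁ 0 0 (fromBlocks Ā₁ᵀ 0 0 ((0 : ℝ) • (1 : Matrix ρ ρ ℝ))))
    (fromBlocks A₂ 0 0 (fromBlocks Ā₂ᵀ 0 0 ((0 : ℝ) • (1 : Matrix ρ ρ ℝ))))
    hL hM hR uL uR
  -- read the three words
  have w0 : fromBlocks A₀ᵀ 0 0 (fromBlocks Ā₀ 0 0 ((1 : ℝ) • (1 : Matrix ρ ρ ℝ)))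
        * (kkt K₀ (fromRows Q₀ (τ * B₀)) * fromBlocks A₀ 0 0 (fromBlocks Ā₀ᵀ 0 0 ((1 : ℝ) • (1 : Matrix ρ ρ ℝ))))
      = kkt (A₀ᵀ * K₀ * A₀) (fromRows (Ā₀ * Q₀ * A₀) τ) := by
    rw [← Matrix.mul_assoc]; exact conj_kkt_base A₀ B₀ K₀ Ā₀ Q₀ τ b0
  have w1 := conj_kkt_first A₀ A₁ B₀ B₁ K₀ K₁ Ā₀ Ā₁ Q₀ Q₁ τ b1
  have w2 := conj_kkt_second A₀ A₁ A₂ B₀ B₁ B₂ K₀ K₁ K₂ Ā₀ Ā₁ Ā₂ Q₀ Q₁ Q₂ τ b2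
  dsimp only at w2
  rw [w0, w1, w2] at h
  exact h

end Assembled

end Summit.QuantumFields.BalabanUV.Beta.FP.SliceTransportConjugationEnd

end
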